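import Summits.BirchSwinnertonDyer.BirchSwinnertonDyer.Theorems.Rank1ResidualX1RankOneOddPrime
import Literature.NumberTheory.EllipticCurves.Rank1Residual.ClassX1KellerYinMainConjecture

/-!
# Rank-≤1 BSD residual class X1: what the announced Keller–Yin theorem buys on the CYCLOTOMIC side —
# Mazur's main conjecture at every rank-one X1 pair with the Schneider certificate

HONEST FRAMING (cell `b2b-bsdres`, home `run/shared/lean/b2b/bsd-rank1-residual/`, unit
`b2b-bsdres-x1a`, prover A = the Keller–Yin route, GEN 4). The goal is to DELETE the COMBINATION-SHAPED
residual classes for ALL analytic-rank `≤ 1` curves over `ℚ` — "full BSD formula for every rank `≤ 1`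
curve in class C" assembled STRICTLY from published theorems — so that the rank-`≤ 1` remainder becomes
exactly the CONSTRUCTION-SHAPED classes, which are TYPED (missing-input `Prop`s), NOT attempted; this
is not "finishing BSD". Helper file of the crux `PAdicOrderMainConjectureR5`
(stmt-BirchSwinnertonDyer-15418), continuation of `Rank1ResidualX1Defs` (prover A gens 1–3) in the light
of `Rank1ResidualX1RankOneOddPrime` (prover B gen 4: at every rank-one X1 pair, `p = 3` included,
`MazurMainConjecture W p ↔ BSDp W p` modulo the Schneider certificate, from published theorems).
Nothing here closes X1 or changes a census verdict.

The two typed open inputs of class X1 (`Rank1ResidualX1Defs`) are (1) Keller–Yin's rank-one display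
`KellerYin2024.thm421_rankOne_display_OPEN` (ANNOUNCED: arXiv:2402.12781v2, proof of Thm. 4.2.1, resting
on their Thms. 3.0.11 + 7.0.6) and (2) Mazur's cyclotomic main conjecture at anomalous Eisenstein primes
of parity type A, `MazurMainConjectureOnX1TypeA` (UNSTATED in print: Greenberg–Vatsal 2000 p. 5 "we can
prove neither [μ = 0] … we don't know how to prove λ^alg = λ^anal" for even twists of `11a` at `5`;
Castella–Grossi–Skinner 2025 Thm. 1 excludes `φ|_{G_p} ∈ {1, ω}`; Keller–Yin §0.5 and Yin 2024 claim it
in prose). Theorems of this file (compositions of prover A gen 1–2 and prover B gen 4; no new fact):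

* `mazurMainConjecture_of_KY_of_analyticRank_eq_one` — (1) + PUBLISHED facts ⟹ `MazurMainConjecture W p`
  at EVERY X1 pair with `ord_{s=1} L(E,s) = 1` carrying the Schneider certificate (type A: display ⟹
  `BSDp` (gen 1) ⟹ MC (B gen 4 iff); type B: Greenberg–Vatsal outright). The preprint's authors do not
  state this cyclotomic consequence; on the published record their rank-one theorem implies it.
* `forall_mazurMainConjecture_rankLeOne_of_KY_of_mazurMC_rankZero` — (1) + Mazur's MC at the RANK-ZERO
  X1 pairs (gen 2's sharpened residue) + the rank-one certificates ⟹ Mazur's MC at every X1 pair of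
  analytic rank `≤ 1` (gen 2's `bsdpOnClassX1_of_KY_of_mazurMC_rankZero` composed with B gen 4's
  `mazurMainConjecture_of_bsdpOnClassX1_of_analyticRank_le_one`).
* `mazurMCOnX1TypeA_rankLeOne_iff_rankZero_of_KY` — hence, granted (1) and the rank-one certificates,
  the typed residue (2) restricted to `r_an ≤ 1` is EQUIVALENT to its rank-zero slice: the preprint, if
  correct, leaves of X1 exactly "Mazur's main conjecture at the RANK-ZERO anomalous Eisenstein pairs of
  type A" (per pair a theorem wherever `p ∤ #Ш(E/ℚ)_an`, x1b gen 2 — every census pair).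

References: [KellerYin2024] Thm. 4.2.1, p. 22, §0.5; [GreenbergVatsal2000] Thm. (1.3), p. 5;
[CastellaGrossiSkinner2025] Thm. 1; [Wuthrich2014] Thm. 16, §6; [PerrinRiou1987] §1.4 Cor. 1.8;
[BalakrishnanMullerStein2015] Thm. 1.7; [Balakrishnan2016] §2; [GreenbergLNM1716] Thm. 4.1;
[Miller2011LMS] Def. 1.1.
-/

noncomputable section

open scoped Classical MatrixGroups ModularForm

open CongruenceSubgroup WeierstrassCurve Literature.NumberTheory.EllipticCurves
  Literature.NumberTheory.EllipticCurves.ModularForms Literature.NumberTheory.EllipticCurves.Rank1Residual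
  Summit.BirchSwinnertonDyer.BirchSwinnertonDyer.Theorems.Rank1ResidualX1Defs
  Summit.BirchSwinnertonDyer.BirchSwinnertonDyer.Theorems.Rank1ResidualX1RankOneOddPrime

set_option linter.dupNamespace false
set_option autoImplicit false

namespace Summit.BirchSwinnertonDyer.BirchSwinnertonDyer.Theorems.Rank1ResidualX1KellerYinMainConjecture

/-- **Keller–Yin's rank-one display ⟹ `MazurMainConjecture W p` at every rank-one X1 pair with the
Schneider certificate.** For `W/ℚ` globally minimal elliptic and `p` prime with `ClassX1 W p`,
`ord_{s=1} L(E,s) = 1` and Schneider's non-degeneracy of THE canonical cyclotomic `p`-adic height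
(`hSch`): inputs the OPEN `KellerYin2024.thm421_rankOne_display_OPEN` (`hKY`, preprint — a hypothesis,
never a theorem) and the PUBLISHED named facts Greenberg–Vatsal 2000 Thm. 1.3 (`hGV`), Greenberg 1999
Thm. 4.1 (`hGr`), modularity (`hmod`, `hmod'`), Hoffstein–Luo 1997 (`hHL`), Gross–Zagier 1986 I.7.3
(`hGZ`), GZK (`hGZK`), Wuthrich 2014 Thm. 16 (`hW16`), Perrin-Riou–Schneider at odd `p` (`hS`),
Perrin-Riou 1987 at odd `p` (`hPR`), Mazur–Tate sigma at odd `p` (`hMT`). Type A: display ⟹ `BSDp W p`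
(prover A gen 1) ⟹ MC (prover B gen 4's iff); type B: `hGV` outright.
[cite: KellerYin2024, Thm. 4.2.1 and its proof (p. 22); §0.5 (prose claim only)]
[cite: GreenbergVatsal2000, Thm. (1.3)] [cite: Wuthrich2014, Thm. 16 (p. 393) and §6 (p. 400)]
[cite: PerrinRiou1987, §1.4 Cor. 1.8] [cite: BalakrishnanMullerStein2015, Thm. 1.7] -/
theorem mazurMainConjecture_of_KY_of_analyticRank_eq_one
    (hKY : KellerYin2024.thm421_rankOne_display_OPEN)
    (hGV : GreenbergVatsal2000.thm13_charIdeal_eq_of_gvPar) (hGr : greenberg_charValue_rankZero)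
    (hmod : nonempty_modularParametrizationData) (hmod' : exists_isNewformOf)
    (hHL : HoffsteinLuo1997_exists_twist_L_one_ne_zero) (hGZ : GrossZagier1986_thm_I_7_3)
    (hGZK : rank_eq_analyticRank_of_analyticRank_le_one)
    (hW16 : Wuthrich2014.charIdeal_dvd_padicLFunction) (hS : Schneider1985_order_charGenerator_odd)
    (hPR : perrinRiou_rankOne_leadingTerms_odd) (hMT : mazur_tate_sigma_exists_odd)
    (W : WeierstrassCurve ℚ) [W.IsElliptic] [W.IsGloballyMinimal] (p : ℕ) [Fact p.Prime]
    (hX1 : ClassX1 W p) (hr1 : W.analyticRank = 1)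
    (hSch : ∀ Dh : PAdicHeightData W p, Dh.IsCanonical → SchneiderConjecture Dh) :
    MazurMainConjecture W p :=
  X1.mainConjecture_of_KY_OPEN_of_analyticRank_eq_one hKY hGV hGr hmod hmod' hHL hGZ hGZK hW16 hS hPR
    hMT W p hX1 hr1 hSch

/-- **Keller–Yin's display + Mazur's MC at the RANK-ZERO X1 pairs + the rank-one certificates ⟹
Mazur's main conjecture at EVERY X1 pair of analytic rank `≤ 1`.** Gen 2 showed that these two open
inputs give the typed target `BSDpOnClassX1` (`bsdpOnClassX1_of_KY_of_mazurMC_rankZero`); prover B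
gen 4 showed that the target returns `MazurMainConjecture W p` at every pair of analytic rank `≤ 1`
modulo the rank-one certificates (`mazurMainConjecture_of_bsdpOnClassX1_of_analyticRank_le_one`).
[cite: KellerYin2024, Thm. 4.2.1 (p. 22)] [cite: Wuthrich2014, Thm. 16 and §6]
[cite: GreenbergLNM1716, Thm. 4.1] [cite: PerrinRiou1987, §1.4 Cor. 1.8] -/
theorem forall_mazurMainConjecture_rankLeOne_of_KY_of_mazurMC_rankZero
    (hA0 : ∀ (W : WeierstrassCurve ℚ) [W.IsElliptic] [W.IsGloballyMinimal] (p : ℕ) [Fact p.Prime],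
      ClassX1 W p → W.analyticRank = 0 → MazurMainConjecture W p)
    (hKY : KellerYin2024.thm421_rankOne_display_OPEN)
    (hSchX1 : ∀ (W : WeierstrassCurve ℚ) [W.IsElliptic] [W.IsGloballyMinimal] (p : ℕ) [Fact p.Prime],
      ClassX1 W p → W.analyticRank = 1 →
        ∀ Dh : PAdicHeightData W p, Dh.IsCanonical → SchneiderConjecture Dh)
    (hGV : GreenbergVatsal2000.thm13_charIdeal_eq_of_gvPar) (hGr : greenberg_charValue_rankZero)
    (hmod : nonempty_modularParametrizationData) (hmod' : exists_isNewformOf)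
    (hHL : HoffsteinLuo1997_exists_twist_L_one_ne_zero) (hGZ : GrossZagier1986_thm_I_7_3)
    (hGZK : rank_eq_analyticRank_of_analyticRank_le_one)
    (hW16 : Wuthrich2014.charIdeal_dvd_padicLFunction) (hS : Schneider1985_order_charGenerator_odd)
    (hPR : perrinRiou_rankOne_leadingTerms_odd) (hMT : mazur_tate_sigma_exists_odd)
    (W : WeierstrassCurve ℚ) [W.IsElliptic] [W.IsGloballyMinimal] (p : ℕ) [Fact p.Prime]
    (hX1 : ClassX1 W p) (hr : W.analyticRank ≤ 1) :
    MazurMainConjecture W p :=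
  mazurMainConjecture_of_bsdpOnClassX1_of_analyticRank_le_one
    (bsdpOnClassX1_of_KY_of_mazurMC_rankZero hA0 hKY hGV hGr hmod hmod' hHL hGZ hGZK)
    hGr hW16 hS hPR hMT hmod hGZK W p hX1 hr (fun h1 ↦ hSchX1 W p hX1 h1)

/-- **Granted the announced display and the rank-one certificates, the typed residue of X1 on
`r_an ≤ 1` is its RANK-ZERO slice:** "Mazur's main conjecture at every type-A X1 pair of analytic rank
`≤ 1`" ⟺ "Mazur's main conjecture at every X1 pair of analytic rank `0`" (rank-zero X1 pairs are of
type A by the class predicate; the forward direction is restriction). What the preprint would leave of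
X1 is therefore exactly the rank-zero anomalous type-A main conjecture — per pair a theorem wherever
`p ∤ #Ш(E/ℚ)_an` (`Rank1ResidualX1Converse`, x1b gen 2). [cite: KellerYin2024, Thm. 4.2.1 (p. 22); §0.5]
[cite: GreenbergVatsal2000, Thm. (1.3) and p. 5] [cite: Wuthrich2014, Thm. 16 and §6] -/
theorem mazurMCOnX1TypeA_rankLeOne_iff_rankZero_of_KY
    (hKY : KellerYin2024.thm421_rankOne_display_OPEN)
    (hSchX1 : ∀ (W : WeierstrassCurve ℚ) [W.IsElliptic] [W.IsGloballyMinimal] (p : ℕ) [Fact p.Prime],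
      ClassX1 W p → W.analyticRank = 1 →
        ∀ Dh : PAdicHeightData W p, Dh.IsCanonical → SchneiderConjecture Dh)
    (hGV : GreenbergVatsal2000.thm13_charIdeal_eq_of_gvPar) (hGr : greenberg_charValue_rankZero)
    (hmod : nonempty_modularParametrizationData) (hmod' : exists_isNewformOf)
    (hHL : HoffsteinLuo1997_exists_twist_L_one_ne_zero) (hGZ : GrossZagier1986_thm_I_7_3)
    (hGZK : rank_eq_analyticRank_of_analyticRank_le_one)
    (hW16 : Wuthrich2014.charIdeal_dvd_padicLFunction) (hS : Schneider1985_order_charGenerator_odd)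
    (hPR : perrinRiou_rankOne_leadingTerms_odd) (hMT : mazur_tate_sigma_exists_odd) :
    (∀ (W : WeierstrassCurve ℚ) [W.IsElliptic] [W.IsGloballyMinimal] (p : ℕ) [Fact p.Prime],
        ClassX1 W p → ¬ GVPar W p → W.analyticRank ≤ 1 → MazurMainConjecture W p) ↔
      ∀ (W : WeierstrassCurve ℚ) [W.IsElliptic] [W.IsGloballyMinimal] (p : ℕ) [Fact p.Prime],
        ClassX1 W p → W.analyticRank = 0 → MazurMainConjecture W p := by
  constructor
  · intro h W _ _ p _ hX1 hr0
    -- a rank-zero X1 pair is of type A: the class predicate excludes `r = 0 ∧ gvpar`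
    have hA : ¬ GVPar W p := fun hpar ↦ hX1.2.2.2.2 ⟨hr0, hpar⟩
    exact h W p hX1 hA (by omega)
  · intro hA0 W _ _ p _ hX1 _ hr
    exact forall_mazurMainConjecture_rankLeOne_of_KY_of_mazurMC_rankZero hA0 hKY hSchX1 hGV hGr hmod
      hmod' hHL hGZ hGZK hW16 hS hPR hMT W p hX1 hr

/-! ### Appended (gen 4): Keller–Yin's Theorem 4.2.1 AS STATED (both ranks) and the cyclotomic side

`KellerYin2024.thm421_pPart_OPEN` is the verbatim transcription of Thm. 4.2.1 (= Thm. 3 of the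
Introduction of arXiv:2402.12781v2: `p > 2` good, `E[p]` reducible, `r_an ∈ {0,1}` ⟹ the `p`-part of the
BSD formula), OPEN hypothesis; its rank-`0` clause rests, inside the preprint, on the §0.5 prose claim
(X1-CHAIN §2 L10). On the published record the statement itself already IMPLIES the cyclotomic main
conjecture it presupposes: -/

/-- **Keller–Yin's Thm. 4.2.1 as stated ⟹ `MazurMainConjecture W p` at every X1 pair of analytic rank
`≤ 1`** (rank `0`: no certificate — x1b gen 2's `mazurMainConjecture_iff_bsdp`, from Wuthrich Thm. 16,
Greenberg Thm. 4.1, modularity, GZK; rank `1`: modulo the Schneider certificate — x1b gen 4's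
`mazurMainConjecture_iff_bsdp_of_analyticRank_eq_one`, adding Perrin-Riou–Schneider, Perrin-Riou 1987
and the Mazur–Tate sigma function at odd `p`). The bridge `PPart ⟹ BSDp` is `bsdp_of_pPart`
(modularity `hmod'`, GZK). So the preprint's headline theorem, if true, proves Mazur's main conjecture at
every anomalous Eisenstein pair of parity type A with `r_an ≤ 1` — the statement its authors assert only
in prose (§0.5) — at rank `0` outright and at rank `1` wherever the canonical `p`-adic height is
non-degenerate. [cite: KellerYin2024, Thm. 4.2.1 (p. 22) and §0.5]
[cite: Wuthrich2014, Thm. 16 (p. 393) and §6 (p. 400)] [cite: GreenbergLNM1716, Thm. 4.1]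
[cite: PerrinRiou1987, §1.4 Cor. 1.8] [cite: BalakrishnanMullerStein2015, Thm. 1.7] -/
theorem mazurMainConjecture_of_KY_pPart_of_analyticRank_le_one
    (hKY3 : KellerYin2024.thm421_pPart_OPEN)
    (hmod' : exists_isNewformOf) (hGZK : rank_eq_analyticRank_of_analyticRank_le_one)
    (hW16 : Wuthrich2014.charIdeal_dvd_padicLFunction) (hGr : greenberg_charValue_rankZero)
    (hmod : nonempty_modularParametrizationData) (hS : Schneider1985_order_charGenerator_odd)
    (hPR : perrinRiou_rankOne_leadingTerms_odd) (hMT : mazur_tate_sigma_exists_odd)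
    (W : WeierstrassCurve ℚ) [W.IsElliptic] [W.IsGloballyMinimal] (p : ℕ) [Fact p.Prime]
    (hX1 : ClassX1 W p) (hr : W.analyticRank ≤ 1)
    (hSch : W.analyticRank = 1 → ∀ Dh : PAdicHeightData W p, Dh.IsCanonical → SchneiderConjecture Dh) :
    MazurMainConjecture W p := by
  have hX := isClassX1_of_classX1 hX1
  have hB : BSDp W p :=
    bsdp_of_pPart W p (WeierstrassCurve.hasEntireLFunction_rat_of_exists_isNewformOf hmod') hGZK hr
      (hKY3 W p hX1.1.ne' hX.hasGoodReductionAtPrime hX.not_hasIrreducibleModPGaloisRep hr)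
  rcases Nat.le_one_iff_eq_zero_or_eq_one.mp hr with h0 | h1
  · exact (Rank1ResidualX1Converse.mazurMainConjecture_iff_bsdp hW16 hGr hmod hGZK W p hX1 h0).mpr hB
  · exact (mazurMainConjecture_iff_bsdp_of_analyticRank_eq_one hW16 hS hPR hMT hmod hGZK W p hX1 h1
      (hSch h1)).mpr hB

/-- **Corollary (class form): Keller–Yin's Thm. 4.2.1 as stated + the rank-one certificates ⟹ the typed
residue `MazurMainConjectureOnX1TypeA` on its analytic-rank-`≤ 1` part.**
[cite: KellerYin2024, Thm. 4.2.1 (p. 22) and §0.5] [cite: Wuthrich2014, Thm. 16 and §6] -/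
theorem forall_mazurMainConjecture_rankLeOne_of_KY_pPart
    (hKY3 : KellerYin2024.thm421_pPart_OPEN)
    (hSchX1 : ∀ (W : WeierstrassCurve ℚ) [W.IsElliptic] [W.IsGloballyMinimal] (p : ℕ) [Fact p.Prime],
      ClassX1 W p → W.analyticRank = 1 →
        ∀ Dh : PAdicHeightData W p, Dh.IsCanonical → SchneiderConjecture Dh)
    (hmod' : exists_isNewformOf) (hGZK : rank_eq_analyticRank_of_analyticRank_le_one)
    (hW16 : Wuthrich2014.charIdeal_dvd_padicLFunction) (hGr : greenberg_charValue_rankZero)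
    (hmod : nonempty_modularParametrizationData) (hS : Schneider1985_order_charGenerator_odd)
    (hPR : perrinRiou_rankOne_leadingTerms_odd) (hMT : mazur_tate_sigma_exists_odd) :
    ∀ (W : WeierstrassCurve ℚ) [W.IsElliptic] [W.IsGloballyMinimal] (p : ℕ) [Fact p.Prime],
      ClassX1 W p → W.analyticRank ≤ 1 → MazurMainConjecture W p :=
  fun W _ _ p _ hX1 hr ↦
    mazurMainConjecture_of_KY_pPart_of_analyticRank_le_one hKY3 hmod' hGZK hW16 hGr hmod hS hPR hMT W p
      hX1 hr (fun h1 ↦ hSchX1 W p hX1 h1)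

/-! ### Appended (gen 5): the converse direction — restricted to X1 ∩ {r_an ≤ 1} and granted the
rank-one certificates, Keller–Yin's Theorem 4.2.1 (its class-X1 instances, print shape `PPart`) and
Mazur's main conjecture are ONE AND THE SAME statement on the published record

Gen 4 proved `thm421_pPart_OPEN ⟹ MazurMainConjecture` at every X1 pair with `r_an ≤ 1`; the theorems
below add the converse from the same PUBLISHED facts (MC ⟹ `BSDp`: prover B's iffs
`Rank1ResidualX1Converse.mazurMainConjecture_iff_bsdp` (rank `0`) and
`Rank1ResidualX1RankOneOddPrime.mazurMainConjecture_iff_bsdp_of_analyticRank_eq_one` (rank `1`, modulo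
Schneider's certificate); `BSDp ⟹ PPart`: prover A gen 2's `pPart_of_bsdp`, modularity + GZK) and
package the equivalence of the two ∀-statements over X1 ∩ {r_an ≤ 1}. Reading for the census: naming the
X1 residual "Keller–Yin's announced Theorem 3 on the anomalous classes" or "Mazur's cyclotomic main
conjecture at anomalous Eisenstein pairs of parity type A with r_an ≤ 1" is, modulo the rank-one
certificates (683/683 in hand numerically at `p = 3`, 71/71 at `p ≥ 5`; cell files
`b2b-bsdres-x1a/x1_rank1_p3_certificates_x1a.tsv`, `b2b-bsdres-x1b/gen3/x1_rank1_p5_certificates.tsv`),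
a choice of words, not of mathematics. No label change; nothing closed. -/

/-- **Mazur's (MC) at an X1 pair of analytic rank `≤ 1` ⟹ the `p`-part of BSD in Keller–Yin's print
shape `PPart W p`** (rank `0` outright; rank `1` modulo the Schneider certificate `hSch`) — the converse
of `mazurMainConjecture_of_KY_pPart_of_analyticRank_le_one`, from the same PUBLISHED named facts:
Wuthrich 2014 Thm. 16 (`hW16`), Greenberg LNM 1716 Thm. 4.1 (`hGr`), modularity (`hmod`, `hmod'`),
Gross–Zagier–Kolyvagin (`hGZK`), Perrin-Riou–Schneider at odd `p` (`hS`), Perrin-Riou 1987 at odd `p`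
(`hPR`), the Mazur–Tate sigma function at odd `p` (`hMT`).
[cite: Wuthrich2014, Thm. 16 (p. 393) and §6 (p. 400)] [cite: GreenbergLNM1716, Thm. 4.1]
[cite: PerrinRiou1987, §1.4 Cor. 1.8] [cite: BalakrishnanMullerStein2015, Thm. 1.7]
[cite: KellerYin2024, Thm. 4.2.1 (p. 22)] -/
theorem pPart_of_mazurMainConjecture_of_analyticRank_le_one
    (hmod' : exists_isNewformOf) (hGZK : rank_eq_analyticRank_of_analyticRank_le_one)
    (hW16 : Wuthrich2014.charIdeal_dvd_padicLFunction) (hGr : greenberg_charValue_rankZero)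
    (hmod : nonempty_modularParametrizationData) (hS : Schneider1985_order_charGenerator_odd)
    (hPR : perrinRiou_rankOne_leadingTerms_odd) (hMT : mazur_tate_sigma_exists_odd)
    (W : WeierstrassCurve ℚ) [W.IsElliptic] [W.IsGloballyMinimal] (p : ℕ) [Fact p.Prime]
    (hX1 : ClassX1 W p) (hr : W.analyticRank ≤ 1)
    (hSch : W.analyticRank = 1 → ∀ Dh : PAdicHeightData W p, Dh.IsCanonical → SchneiderConjecture Dh)
    (hMC : MazurMainConjecture W p) : PPart W p := by
  have hB : BSDp W p := by
    rcases Nat.le_one_iff_eq_zero_or_eq_one.mp hr with h0 | h1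
    · exact (Rank1ResidualX1Converse.mazurMainConjecture_iff_bsdp hW16 hGr hmod hGZK W p hX1 h0).mp hMC
    · exact (mazurMainConjecture_iff_bsdp_of_analyticRank_eq_one hW16 hS hPR hMT hmod hGZK W p hX1 h1
        (hSch h1)).mp hMC
  exact pPart_of_bsdp (WeierstrassCurve.hasEntireLFunction_rat_of_exists_isNewformOf hmod') hGZK W p hr hB

/-- **Keller–Yin's Thm. 4.2.1 as stated (OPEN hypothesis) yields its class-X1 instances**: for every X1
pair with `r_an ≤ 1`, `PPart W p` (`ClassX1` forces `2 < p`, good reduction at `p` and `E[p]`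
reducible). Bookkeeping only; the hypothesis is an unrefereed claim. [cite: KellerYin2024, Thm. 4.2.1 (p. 22)] -/
theorem forall_pPart_rankLeOne_of_KY_pPart (hKY3 : KellerYin2024.thm421_pPart_OPEN) :
    ∀ (W : WeierstrassCurve ℚ) [W.IsElliptic] [W.IsGloballyMinimal] (p : ℕ) [Fact p.Prime],
      ClassX1 W p → W.analyticRank ≤ 1 → PPart W p := by
  intro W _ _ p _ hX1 hr
  have hX := isClassX1_of_classX1 hX1
  exact hKY3 W p hX1.1.ne' hX.hasGoodReductionAtPrime hX.not_hasIrreducibleModPGaloisRep hr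

/-- **Class level: on X1 ∩ {r_an ≤ 1}, granted the rank-one Schneider certificates (`hSchX1`) and the
PUBLISHED named facts, "the `p`-part of BSD in print shape at every pair" (the class-X1 instances of
Keller–Yin's announced Thm. 4.2.1) ⟺ "Mazur's main conjecture at every pair"** (the typed residue
`MazurMainConjectureOnX1TypeA` on its `r_an ≤ 1` part, type-B pairs being Greenberg–Vatsal's theorem
anyway). ⟹ is gen 4's `forall_mazurMainConjecture_rankLeOne_of_KY_pPart` with the OPEN hypothesis
replaced by the class-restricted ∀-statement; ⟸ is `pPart_of_mazurMainConjecture_of_analyticRank_le_one`.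
[cite: KellerYin2024, Thm. 4.2.1 (p. 22) and §0.5] [cite: Wuthrich2014, Thm. 16 (p. 393) and §6 (p. 400)]
[cite: GreenbergLNM1716, Thm. 4.1] [cite: PerrinRiou1987, §1.4 Cor. 1.8]
[cite: BalakrishnanMullerStein2015, Thm. 1.7] -/
theorem forall_pPart_iff_forall_mazurMainConjecture_rankLeOne
    (hSchX1 : ∀ (W : WeierstrassCurve ℚ) [W.IsElliptic] [W.IsGloballyMinimal] (p : ℕ) [Fact p.Prime],
      ClassX1 W p → W.analyticRank = 1 →
        ∀ Dh : PAdicHeightData W p, Dh.IsCanonical → SchneiderConjecture Dh)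
    (hmod' : exists_isNewformOf) (hGZK : rank_eq_analyticRank_of_analyticRank_le_one)
    (hW16 : Wuthrich2014.charIdeal_dvd_padicLFunction) (hGr : greenberg_charValue_rankZero)
    (hmod : nonempty_modularParametrizationData) (hS : Schneider1985_order_charGenerator_odd)
    (hPR : perrinRiou_rankOne_leadingTerms_odd) (hMT : mazur_tate_sigma_exists_odd) :
    (∀ (W : WeierstrassCurve ℚ) [W.IsElliptic] [W.IsGloballyMinimal] (p : ℕ) [Fact p.Prime],
        ClassX1 W p → W.analyticRank ≤ 1 → PPart W p) ↔
      (∀ (W : WeierstrassCurve ℚ) [W.IsElliptic] [W.IsGloballyMinimal] (p : ℕ) [Fact p.Prime],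
        ClassX1 W p → W.analyticRank ≤ 1 → MazurMainConjecture W p) := by
  constructor
  · intro h W _ _ p _ hX1 hr
    have hB : BSDp W p :=
      bsdp_of_pPart W p (WeierstrassCurve.hasEntireLFunction_rat_of_exists_isNewformOf hmod') hGZK hr
        (h W p hX1 hr)
    rcases Nat.le_one_iff_eq_zero_or_eq_one.mp hr with h0 | h1
    · exact (Rank1ResidualX1Converse.mazurMainConjecture_iff_bsdp hW16 hGr hmod hGZK W p hX1 h0).mpr hB
    · exact (mazurMainConjecture_iff_bsdp_of_analyticRank_eq_one hW16 hS hPR hMT hmod hGZK W p hX1 h1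
        (hSchX1 W p hX1 h1)).mpr hB
  · intro h W _ _ p _ hX1 hr
    exact pPart_of_mazurMainConjecture_of_analyticRank_le_one hmod' hGZK hW16 hGr hmod hS hPR hMT W p hX1
      hr (fun h1 ↦ hSchX1 W p hX1 h1) (h W p hX1 hr)

/-- **Corollary: `BSDpOnClassX1`-style closure of X1 ∩ {r_an ≤ 1} in print shape from Mazur's main
conjecture there** — with the certificates, `MazurMainConjecture` at every X1 pair of analytic rank `≤ 1`
gives `PPart` (hence Miller's `BSDp`, `bsdp_of_pPart`) at every such pair: the published record needs
NO anticyclotomic input (Keller–Yin 3.0.11 / 7.0.6) once the cyclotomic main conjecture is granted —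
prover B's thesis, here in prover A's currency. [cite: Wuthrich2014, Thm. 16 (p. 393) and §6 (p. 400)]
[cite: GreenbergLNM1716, Thm. 4.1] [cite: PerrinRiou1987, §1.4 Cor. 1.8] -/
theorem forall_pPart_rankLeOne_of_forall_mazurMainConjecture
    (hSchX1 : ∀ (W : WeierstrassCurve ℚ) [W.IsElliptic] [W.IsGloballyMinimal] (p : ℕ) [Fact p.Prime],
      ClassX1 W p → W.analyticRank = 1 →
        ∀ Dh : PAdicHeightData W p, Dh.IsCanonical → SchneiderConjecture Dh)
    (hmod' : exists_isNewformOf) (hGZK : rank_eq_analyticRank_of_analyticRank_le_one)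
    (hW16 : Wuthrich2014.charIdeal_dvd_padicLFunction) (hGr : greenberg_charValue_rankZero)
    (hmod : nonempty_modularParametrizationData) (hS : Schneider1985_order_charGenerator_odd)
    (hPR : perrinRiou_rankOne_leadingTerms_odd) (hMT : mazur_tate_sigma_exists_odd)
    (hMC : ∀ (W : WeierstrassCurve ℚ) [W.IsElliptic] [W.IsGloballyMinimal] (p : ℕ) [Fact p.Prime],
      ClassX1 W p → W.analyticRank ≤ 1 → MazurMainConjecture W p) :
    ∀ (W : WeierstrassCurve ℚ) [W.IsElliptic] [W.IsGloballyMinimal] (p : ℕ) [Fact p.Prime],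
      ClassX1 W p → W.analyticRank ≤ 1 → PPart W p :=
  (forall_pPart_iff_forall_mazurMainConjecture_rankLeOne hSchX1 hmod' hGZK hW16 hGr hmod hS hPR hMT).mpr hMC

end Summit.BirchSwinnertonDyer.BirchSwinnertonDyer.Theorems.Rank1ResidualX1KellerYinMainConjecture

end
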